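import Literature.MathematicalPhysics.QuantumFieldTheory.Balaban1983to89.B9Eq349BlockDistanceWeight
import Literature.MathematicalPhysics.QuantumFieldTheory.Balaban1983to89.B9Eq315QTorusOnto
import Literature.MathematicalPhysics.QuantumFieldTheory.Balaban1983to89.B5SmoothPartition

/-!
# `Balaban1983to89.B9Eq387CubeReductionGeometry` — T. Bałaban, *Propagators for lattice gauge theories in a background field*, Commun. Math. Phys. **99**
# (1985) 389–434 [Balaban1985BackgroundPropagators] (3.35) p. 396 l. 23 («where O(1)M is a size of □ in T_{L^{−j}}»), p. 408 l. 20–28 («We take a family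
# of cubes □, with centers at points of this lattice, which are unions of 2^d big blocks … The family is a partition of the lattice … For a cube □ and
# n = 1, 2, … we define □̃ⁿ as a cube of the size (2 + 2n)ML^jη, and with the same center as □»), p. 409 l. 2–3; [Balaban1985Averaging] (1)–(2) p. 17 (torus
# distance): **THE TORUS GEOMETRY OF THE PER-CUBE GAUGE REDUCTION — (§1) the `r`-ball of a boxed coarse set is boxed; (§2) CUBE PLACEMENT: the support of the
# smooth partition function `hS_z` of a cube of the `M₀`-cover, read in coarse blocks, sits inside a coarse box with collar `r₀ + R + 1` on each side and
# extent `Nc = 2ρ + 2(r₀+R)` (`Lρ ≥ M₀`), which does not wrap as soon as `2ρ + 2(r₀+R) + 4 ≤ m_i`** — the geometric letters of this lineage's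
# `B9Eq387CubeReductionClosed.cube_loc_closed` ((K10) §1, moved here so that it lands ahead of (K10)'s operator parents) and the junction from ne9-leaf-01's
# Tier-P cubes (`B5SmoothPartition.hS`, `B5TorusCover.Ctr`) to (K10)'s box datum `(y₁, Nc, Z₀)`; route R2′ STEP B8′, rows L10∕L11 of the pub-balaban NE9 chain
# (`t4/ROUTES-NE9.md` v13.46)

statement-level skeleton of published theorems with citation tags; proofs where landed; nothing here is a claim about the Yang–Mills mass gap

CITATION HEADER (lean-in-tree rule).  Audit cell `pub-balaban`, sub-cell `t4`, BINDER row NE9; filed by NE9 formalisation-swarm LEAF PROVER 05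
(`b2b-balaban-t4-ne9-formalise-leaf-05`, gen 79).  [folklore] finite torus arithmetic over the tree's `tdist`∕`circAbs` (`B4Sect5Torus`), `liftSite`
(`B9Eq315QTorusOnto`), `blockCoord` (`B9Eq319QprimeTorus`), ne9-leaf-01's block-distance letter `B9Eq349BlockDistanceWeight.mul_tdist_blockCoord_sub_le_tdist`
and the OWNER's smooth partition `B5SmoothPartition.hS` with its support letter `hS_eq_zero_of_le`.  Source READ: [Balaban1985BackgroundPropagators] p. 396
(3.35) l. 23, p. 408 l. 20–33, p. 409 l. 2–3 (cubes with centres on the `M`-lattice, their enlargements □̃ⁿ, «number O(1) in the condition (3.35) can be taken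
as equal to 12, thus the cube □̃ is contained in one of the cubes for which this condition holds»).  Print's geometry is by `M = KR₀M₀` big blocks; the tree's
is the `M₀`-cover of `B5TorusCover` on the fine torus `fineP L m` read through `blockCoord` on the coarse torus `m` — a MODEL reading, numbers not print's.

WHY.  (K10) `cube_loc_closed` ∕ `B9Eq387CubeReductionClosedAdmissible.cube_loc_closed_admissible` estimate bond fields supported over the blocks of a coarse
set `Z₀ ⊆ y₁ + [r₀+R+1, Nc+1−(r₀+R)]` with `Nc + 4 ≤ m`; ne9-leaf-01's Tier P (`B9Eq387IMSTierPSmallField.ims_tierP_small_background`, staged) asks (loc)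
for the localised fields `χ_B(z)A = hS_z • A`, `z ∈ Ctr (fineP L m) M₀`.  §2 supplies, for every centre `z`, the box datum with `hS_z • A` supported over
`Z₀`'s blocks — so (K10)'s estimate applies to `χ_B(z)A` — provided the volume has room for support plus collars: `2ρ + 2(r₀+R) + 4 ≤ m_i`.  HONEST
LIMIT (located, not hidden): at the smallest volumes Tier P allows (`2M₀ ≤ Lm_i` only) the support of `hS_z` is the whole torus and NO collar box exists —
the per-cube gauge reduction (small plaquettes ⇒ small gauge on a box that does not wrap) does not serve tori only two cubes across (torus cycles); those
volumes need `m_i ≥ 2ρ + 2(r₀+R) + 4`, i.e. a LARGER volume-to-cube ratio, or another input.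

WHAT IS PROVED (sorry-free; proof lane — no `def`; [folklore]).
* §1 `exists_step_of_circAbs_le`, `exists_step_of_tdist_le` (radius `r`), **`liftSite_sub_mem_of_tdist_le`** (the `r`-ball of a boxed coarse set is boxed) —
  formerly (K10) §1.
* §2 **`tdist_blockCoord_ctr_le_of_hS_ne_zero`** (`hS_z(x) ≠ 0`, `M₀ ≤ Lρ` ⊢ `tdist m (blockCoord x) (blockCoord (ctr z)) ≤ ρ`);
  **`exists_box_of_ctr`** — for `z ∈ Ctr (fineP L m) M₀`, `1 ≤ M₀ ≤ Lρ`, `2ρ + 2(r₀+R) + 4 ≤ m_i`: `Nc + 4 ≤ m` for the constant extent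
  `Nc := 2ρ + 2(r₀+R)` (the tight one: collars `r₀+R+1` on both sides of the `ρ`-ball — ne9-leaf-02 g73's located NIT-1, taken), and `∃ y₁ Z₀` with
  `∀ z′ ∈ Z₀, r₀+R+1 ≤ liftSite (z′ − y₁) i ∧ liftSite (z′ − y₁) i + (r₀+R) ≤ Nc_i + 1` and `∀ x, blockCoord x ∉ Z₀ → hS_z(x) = 0`.
HONEST SCOPE.  Geometry only; no operator, no estimate; NOT Tier P, NOT NE9 (cell pub-balaban: NE9 NOT PRINTED ∕ NOT PROVED; «NE9 ⇐ the named binders»; row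
WALLED ON A MODEL (O-NE9-1; #5 UNRULED); spine PROVED 0∕9; rung (B)+1 on a finite T⁴ — NOT infinite volume, NOT mass gap, NOT BetaPertH, NOT Clay; HONEST
DEPENDENCY: continuum YM on T⁴ ⇐ BetaPertH ∧ nine spine estimates (0/9 proved); BetaPertH ⇐ (D1) ∧ (D4) ∧ CAP+tail; G-an2-4 gates asym, D1 and NE2/3/4).
NEW file; nothing modified.  Net new unproved facts: 0.
-/

noncomputable section

set_option autoImplicit false

namespace Literature.MathematicalPhysics.QuantumFieldTheory.Balaban1983to89.B9Eq387CubeReductionGeometry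

open B4TorusKernel.MultiPeriod (circAbs)
open B4Sect5Torus (TSite tdist circAbs_le_tdist tdist_triangle tdist_self tdist_nonneg tdist_symm)
open B9Eq315QTorusOnto (liftSite)
open B9Eq319QprimeTorus (fineP blockCoord)
open B5TorusCover (Ctr ctr)
open B5SmoothPartition (hS hS_eq_zero_of_le)
open B9Eq349BlockDistanceWeight (mul_tdist_blockCoord_sub_le_tdist exists_tdist_eq_circAbs)

variable {d : ℕ}

/-! ## §1 Torus geometry: the `r`-ball of a boxed coarse set is boxed -/

/-- One coordinate of `tdist ≤ r`: `dist(Y − Z, Nℤ) ≤ r` ⇒ `Y + t = Z + N·k` with `|t| ≤ r` (no parity condition: `t := −(v mod N)` or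
`N − (v mod N)`). [folklore] [cite: Balaban1985Averaging, (2) p.17] -/
theorem exists_step_of_circAbs_le {N : ℕ} (hN : 1 ≤ N) {Y Z : ℤ} {r : ℤ} (h : circAbs N (Y - Z) ≤ r) :
    ∃ t k : ℤ, -r ≤ t ∧ t ≤ r ∧ Y + t = Z + N * k := by
  have hN' : (0 : ℤ) < N := by exact_mod_cast hN
  have h0 : 0 ≤ (Y - Z) % (N : ℤ) := Int.emod_nonneg _ hN'.ne'
  have h1 : (Y - Z) % (N : ℤ) < N := Int.emod_lt_of_pos _ hN'
  have hdiv : (N : ℤ) * ((Y - Z) / N) + (Y - Z) % (N : ℤ) = Y - Z := Int.mul_ediv_add_emod _ _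
  unfold circAbs at h
  rcases min_le_iff.1 h with h2 | h2
  · exact ⟨-((Y - Z) % N), (Y - Z) / N, by linarith, by linarith, by linarith⟩
  · exact ⟨N - (Y - Z) % N, (Y - Z) / N + 1, by linarith, by linarith, by linarith⟩

/-- **`tdist m y z ≤ r` = ONE `r`-STEP UP TO PERIODS**: `ỹ_i + t_i = z̃_i + m_i k_i` with `|t_i| ≤ r` (the radius-`r` form of
`B9Eq387CubeReductionGaugeBackground.exists_step_of_tdist_le_one`). [folklore] [cite: Balaban1985Averaging, (2) p.17] -/
theorem exists_step_of_tdist_le {m : Fin d → ℕ} (hm : ∀ i, 1 ≤ m i) (y z : TSite d m) {r : ℕ} (h : tdist m y z ≤ r) :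
    ∃ t k : B7Prop1Explicit.Site d, (∀ i, -(r : ℤ) ≤ t i ∧ t i ≤ r) ∧ ∀ i, liftSite y i + t i = liftSite z i + (m i : ℤ) * k i := by
  have hc : ∀ i, ∃ t k : ℤ, -(r : ℤ) ≤ t ∧ t ≤ r ∧ (((y i : ℕ)) : ℤ) + t = (((z i : ℕ)) : ℤ) + (m i : ℤ) * k := fun i => by
    have h1 : (circAbs (m i) (((y i).val : ℤ) - ((z i).val : ℤ)) : ℝ) ≤ r := (circAbs_le_tdist hm y z i).trans h
    have h2 : circAbs (m i) (((y i).val : ℤ) - ((z i).val : ℤ)) ≤ r := by exact_mod_cast h1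
    exact exists_step_of_circAbs_le (hm i) h2
  choose t k ht using hc
  exact ⟨t, k, fun i => ⟨(ht i).1, (ht i).2.1⟩, fun i => (ht i).2.2⟩

/-- representatives of a difference on `Fin N`. [folklore] -/
private theorem val_sub_cases' {N : ℕ} (a b : Fin N) : ∃ w : ℤ, (((a - b : Fin N) : ℕ) : ℤ) = (a : ℕ) - (b : ℕ) + (N : ℤ) * w := by
  rcases le_or_gt b a with h | h
  · have h1 := Fin.coe_sub_iff_le.2 h; have h2 : (b : ℕ) ≤ (a : ℕ) := h; exact ⟨0, by omega⟩
  · have h1 := Fin.coe_sub_iff_lt.2 h; have h2 : (a : ℕ) < (b : ℕ) := h; have h3 := b.isLt; exact ⟨1, by omega⟩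

/-- two residues in one window are equal. [folklore] -/
private theorem eq_of_window' {P a c q : ℤ} (hP : 0 < P) (ha0 : 0 ≤ a) (haP : a < P) (hc0 : 0 ≤ c) (hcP : c < P)
    (h : a = c + P * q) : a = c := by
  have hq : q = 0 := by
    by_contra hne
    rcases lt_or_gt_of_ne hne with hq | hq
    · have : P * q ≤ P * (-1) := mul_le_mul_of_nonneg_left (by omega) hP.le; linarith
    · have : P * 1 ≤ P * q := mul_le_mul_of_nonneg_left (by omega) hP.le; linarith
  rwa [hq, mul_zero, add_zero] at h

/-- **THE `r`-BALL OF A BOXED COARSE SET IS BOXED**: if every `y ∈ Y₀` has `lo_i ≤ (y − y₁)~_i ≤ hi_i` with `r ≤ lo_i` and `hi_i + r < m_i`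
(no wrap), then every `z` within coarse distance `r` of `Y₀` has `lo_i − r ≤ (z − y₁)~_i ≤ hi_i + r`. [folklore] [cite: Balaban1985Averaging, (2) p.17] -/
theorem liftSite_sub_mem_of_tdist_le {m : Fin d → ℕ} [∀ i, NeZero (m i)] (y₁ : TSite d m) {lo hi : B7Prop1Explicit.Site d} {r : ℕ}
    (hlo : ∀ i, (r : ℤ) ≤ lo i) (hhi : ∀ i, hi i + r < (m i : ℤ)) (Y₀ : Set (TSite d m))
    (hY : ∀ y ∈ Y₀, ∀ i, lo i ≤ liftSite (y - y₁) i ∧ liftSite (y - y₁) i ≤ hi i)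
    (z : TSite d m) (hz : ∃ y ∈ Y₀, tdist m y z ≤ r) (i : Fin d) :
    lo i - r ≤ liftSite (z - y₁) i ∧ liftSite (z - y₁) i ≤ hi i + r := by
  have hm : ∀ i, 1 ≤ m i := fun i => Nat.one_le_iff_ne_zero.mpr (NeZero.ne (m i))
  obtain ⟨y, hyY, hyz⟩ := hz
  obtain ⟨t, k, htb, ht⟩ := exists_step_of_tdist_le hm y z hyz
  have hti := ht i
  have htbi := htb i
  obtain ⟨hs1, hs2⟩ := hY y hyY i
  obtain ⟨w, hw⟩ := val_sub_cases' (y i) (y₁ i)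
  obtain ⟨v, hv⟩ := val_sub_cases' (z i) (y₁ i)
  simp only [liftSite, Pi.sub_apply] at hti hs1 hs2 ⊢
  have hA0 : (0 : ℤ) ≤ (((z i - y₁ i : Fin (m i)) : ℕ) : ℤ) := Nat.cast_nonneg _
  have hAP : (((z i - y₁ i : Fin (m i)) : ℕ) : ℤ) < (m i : ℤ) := by exact_mod_cast (z i - y₁ i).isLt
  have hm0 : (0 : ℤ) < m i := by exact_mod_cast hm i
  have key : (((z i - y₁ i : Fin (m i)) : ℕ) : ℤ) = ((((y i - y₁ i : Fin (m i)) : ℕ) : ℤ) + t i) + (m i : ℤ) * (v - w - k i) := by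
    linear_combination hv - hw - hti
  have hC0 : 0 ≤ (((y i - y₁ i : Fin (m i)) : ℕ) : ℤ) + t i := by linarith [hlo i]
  have hCP : (((y i - y₁ i : Fin (m i)) : ℕ) : ℤ) + t i < (m i : ℤ) := by linarith [hhi i]
  have hAC := eq_of_window' hm0 hA0 hAP hC0 hCP key
  constructor <;> linarith

/-! ## §2 Cube placement: the support of `hS_z`, in coarse blocks, inside a collared box -/

section Placement

variable (L : ℕ) [NeZero L] {m : Fin d → ℕ} [∀ i, NeZero (m i)]

/-- **Support of `hS_z` in coarse blocks**: if `hS_z(x) ≠ 0` and `M₀ ≤ Lρ` then the block of `x` is within coarse torus distance `ρ` of the block of the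
centre `ctr z` (`hS_z` vanishes at fine distance `≥ M₀`; `L·d_m(πx, πx′) − (L−1) ≤ d_{Lm}(x, x′)`). [folklore]
[cite: Balaban1985BackgroundPropagators, p.408 «with the same center as □»; Balaban1985Averaging, (2) p.17] -/
theorem tdist_blockCoord_ctr_le_of_hS_ne_zero (hP : ∀ i, 1 ≤ fineP L m i) {M₀ ρ : ℕ} (hM : 1 ≤ M₀) (hρ : M₀ ≤ L * ρ)
    (z : Ctr (fineP L m) M₀) {x : TSite d (fineP L m)} (hx : hS (fineP L m) M₀ z x ≠ 0) :
    tdist m (blockCoord L m x) (blockCoord L m (ctr hP M₀ z)) ≤ ρ := by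
  have hm : ∀ i, 1 ≤ m i := fun i => Nat.one_le_iff_ne_zero.mpr (NeZero.ne (m i))
  have hL : 1 ≤ L := Nat.one_le_iff_ne_zero.mpr (NeZero.ne L)
  by_contra hgt
  push Not at hgt
  -- the coarse distance is an integer `> ρ`, hence `≥ ρ + 1`
  rcases Nat.eq_zero_or_pos d with hd | hd
  · subst hd
    have h0 : tdist m (blockCoord L m x) (blockCoord L m (ctr hP M₀ z)) = 0 := by
      unfold tdist; rw [Finset.univ_eq_empty, Finset.sup_empty]; simp
    rw [h0] at hgt
    exact absurd hgt (not_lt.mpr (Nat.cast_nonneg ρ))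
  · obtain ⟨i, hi⟩ := exists_tdist_eq_circAbs hm hd (blockCoord L m x) (blockCoord L m (ctr hP M₀ z))
    have hint : ((ρ : ℤ) : ℝ) < (circAbs (m i) ((((blockCoord L m x) i).val : ℤ) - (((blockCoord L m (ctr hP M₀ z)) i).val : ℤ)) : ℝ) := by
      rw [← hi]; exact_mod_cast hgt
    have hint' : (ρ : ℤ) + 1 ≤ circAbs (m i) ((((blockCoord L m x) i).val : ℤ) - (((blockCoord L m (ctr hP M₀ z)) i).val : ℤ)) := by
      have := (Int.cast_lt (R := ℝ)).mp hint
      omega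
    have hge : (ρ : ℝ) + 1 ≤ tdist m (blockCoord L m x) (blockCoord L m (ctr hP M₀ z)) := by
      rw [hi]; exact_mod_cast hint'
    -- fine distance `≥ L(ρ+1) − (L−1) = Lρ + 1 > M₀`
    have hfine := mul_tdist_blockCoord_sub_le_tdist (L := L) hm x (ctr hP M₀ z)
    have hL1 : (1 : ℝ) ≤ L := by exact_mod_cast hL
    have hρ' : (M₀ : ℝ) ≤ (L : ℝ) * ρ := by exact_mod_cast hρ
    have hfar : (M₀ : ℝ) ≤ tdist (fineP L m) x (ctr hP M₀ z) := by nlinarith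
    exact hx (hS_eq_zero_of_le hP hM hfar)

/-- **CUBE PLACEMENT.**  For a centre `z` of the `M₀`-cover of the fine torus (`1 ≤ M₀ ≤ Lρ`) and collar radii `r₀, R`, if `2ρ + 2(r₀+R) + 4 ≤ m_i`
(= `Nc + 4 ≤ m_i` for the constant extent `Nc := 2ρ + 2(r₀+R)`, displayed as the first conjunct in (K10)'s binder form) then there are a corner `y₁`
and a coarse set `Z₀` such that `Z₀ ⊆ y₁ + [r₀+R+1, Nc+1−(r₀+R)]` coordinatewise, and the smooth partition function `hS_z` vanishes at every fine site
whose block is outside `Z₀` — the box datum `(Nc, y₁, Z₀)` of `B9Eq387CubeReductionClosed.cube_loc_closed` for the Tier-P field `hS_z • A`, with ONE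
extent `Nc` for all cubes. [folklore]
[cite: Balaban1985BackgroundPropagators, p.408 «a cube of the size (2 + 2n)ML^jη, and with the same center as □», p.409 «the cube □̃ is contained in one of the cubes for which this condition holds»] -/
theorem exists_box_of_ctr (hP : ∀ i, 1 ≤ fineP L m i) {M₀ ρ : ℕ} (hM : 1 ≤ M₀) (hρ : M₀ ≤ L * ρ) (r₀ R : ℕ)
    (hfit : ∀ i, 2 * ρ + 2 * (r₀ + R) + 4 ≤ m i) (z : Ctr (fineP L m) M₀) :
    ∃ (y₁ : TSite d m) (Z₀ : Finset (TSite d m)),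
      (∀ i, ((2 * ρ + 2 * (r₀ + R) : ℕ) : ℤ) + 4 ≤ (m i : ℤ)) ∧
      (∀ z' ∈ Z₀, ∀ i, ((r₀ + R : ℕ) : ℤ) + 1 ≤ liftSite (z' - y₁) i ∧
        liftSite (z' - y₁) i + (r₀ + R : ℕ) ≤ ((2 * ρ + 2 * (r₀ + R) : ℕ) : ℤ) + 1) ∧
      (∀ x : TSite d (fineP L m), blockCoord L m x ∉ Z₀ → hS (fineP L m) M₀ z x = 0) := by
  classical
  have hm : ∀ i, 1 ≤ m i := fun i => Nat.one_le_iff_ne_zero.mpr (NeZero.ne (m i))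
  -- the centre's block, the shift, the corner, the ball
  set c : TSite d m := blockCoord L m (ctr hP M₀ z) with hc
  let t : TSite d m := fun i => Fin.ofNat (m i) (ρ + r₀ + R + 1)
  refine ⟨c - t, Finset.univ.filter (fun z' : TSite d m => tdist m z' c ≤ (ρ : ℝ)),
    fun i => by have := hfit i; push_cast; omega, ?_, ?_⟩
  · intro z' hz' i
    rw [Finset.mem_filter] at hz'
    have ht : ∀ j, liftSite (c - (c - t)) j = ((ρ + r₀ + R + 1 : ℕ) : ℤ) := fun j => by
      rw [sub_sub_cancel]
      show (((Fin.ofNat (m j) (ρ + r₀ + R + 1) : Fin (m j)) : ℕ) : ℤ) = _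
      have hlt : ρ + r₀ + R + 1 < m j := by have := hfit j; omega
      rw [Fin.val_ofNat, Nat.mod_eq_of_lt hlt]
    have hbox := liftSite_sub_mem_of_tdist_le (c - t) (lo := fun _ => ((ρ + r₀ + R + 1 : ℕ) : ℤ)) (hi := fun _ => ((ρ + r₀ + R + 1 : ℕ) : ℤ))
      (r := ρ) (fun j => by push_cast; omega) (fun j => by have := hfit j; push_cast; omega) {c}
      (fun y hy j => by rw [Set.mem_singleton_iff.mp hy, ht j]; exact ⟨le_rfl, le_rfl⟩) z' ⟨c, rfl, by rw [tdist_symm hm]; exact hz'.2⟩ i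
    constructor
    · push_cast at hbox ⊢; omega
    · push_cast at hbox ⊢; omega
  · intro x hx
    by_contra hne
    apply hx
    rw [Finset.mem_filter]
    exact ⟨Finset.mem_univ _, tdist_blockCoord_ctr_le_of_hS_ne_zero L hP hM hρ z hne⟩

end Placement

end Literature.MathematicalPhysics.QuantumFieldTheory.Balaban1983to89.B9Eq387CubeReductionGeometry

end
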